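import Summits.ResolutionOfSingularities.ResolutionOfSingularities.Theorems.WeightedInvariantIota3SigmaLevelLimitPrelims
import Summits.ResolutionOfSingularities.ResolutionOfSingularities.Theorems.WeightedInvariantIota3SigmaLevelCylinder
import Summits.ResolutionOfSingularities.ResolutionOfSingularities.Theorems.WeightedInvariantIota3SigmaMaximiserOfLevelBound
import Summits.ResolutionOfSingularities.ResolutionOfSingularities.Theorems.WeightedInvariantIota3SigmaDescentDense
import Literature.AlgebraicGeometry.Resolution.AdicCompletionRegular
import HarnessLib

/-!
# P3c≤3 EXISTENCE, (EX-4) middle (L3): THE UNIFORM LEVEL BOUND AT AN ISOLATED POSITION FROM THE DOMINANCE OF MAX-RATIO TWO-FLAGS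
# — the two-flag termination of steepening (door `HypersurfaceCentreConstruction`, stmt-ResolutionOfSingularities-19897; (o70-a) step (EX-4);
# hand res-D-pv-038, design HOME/STATUS 2026-08-27T20:20:38Z)

Topic: `Summits/ResolutionOfSingularities/ResolutionOfSingularities/Theorems`. Helper for the door item `HypersurfaceCentreConstruction`
(stmt-ResolutionOfSingularities-19897, route `WeightedInvariant`), line `local-engine` (L W4.3), def-free.  MAIN THEOREM
`levelBound_of_dominance_isolated`: `S` a regular local G-ring of embedding dimension `> 2`, `f` of order `ν ≥ 1` kept at no prime `≠ 𝔪`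
(ISOLATED), a ratio `a/b` (`0 < b ≤ a`) and the DOMINANCE HYPOTHESIS (DOM_μ) «two two-flags carrying `f` at the same triple `(q ; ta, tb)` are
one-sidedly dominant at it» (res-D-brk-1's (o70-b) word / its level-`μ` variant, SPEC (Δ12) rev 3).  THEN the levels `t/q` of the triples
`(q ; ta, tb)` at which some two-flag carries `f` are BOUNDED: `∃ L, t ≤ L q`.

PROOF = res-type-078's K6 for PAIRS.  If unbounded: (STEP, `exists_next_flag`) from a flag `h` carrying `f` at `(q ; ta, tb)` and ANY bound,
a flag `h'` carrying `f` at a higher triple with `h' ≡ h (mod 𝔪^⌈t/q⌉)` — the higher flag `g'` exists by unboundedness, reaches the lower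
triple (`flagContactFiltration_ratio_antitone_level`), dominates `h` there by (DOM_μ), and the LEVEL-FREE parts of the resulting
decompositions of `h₁, h₂` (`…weight₁_le_big_sup_pow`, `…weight₂_le_span_sup_pow`, p567385) form a two-flag inside `g'`'s higher filtration,
hence carrying `f` there (res-D-brk-1's UPGRADE `flagContactFiltration_eq_of_oneSided`); (SEQUENCE) iterate, levels `≥ k` at stage `k`,
members Cauchy; (LIMIT) `ĥ` in `Ŝ` (`LocalGameEFTContact.exists_limit`); for each `k`, comparing `ĥ` with a late stage, `f` lies in `ĥ`'s
filtration at the stage-`k` triple (pushed to `Ŝ` by `Iota3.map_mem_flagContactFiltration`; upgrade in `Ŝ`); (CYLINDER + DESCENT, p566493)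
`f ∈ (ĥ₁, ĥ₂)^ν`, an equimultiple formal prime `≠ 𝔪̂` — impossible at an isolated position of a G-ring
(`eq_maximalIdeal_adicCompletion_of_isolated`).

[OURS · L1 W4.3 · (o70-a) step (EX-4) (L3)]  Replaces the role of NO printed item; NOT a statement of the manuscript
[claim: Hironaka2017, status: under-review]. AI work, weaker than expert review.  Pure commutative algebra; no named facts; (DOM_μ) is a
hypothesis spelled out in the signature.

## References

* H. Matsumura, *Commutative Ring Theory* (1987), Thm. 8.10/8.11 (Krull, completion), §32 (G-rings). [Matsumura1987]
* H. Hironaka, *Three key theorems on infinitely near singularities*, Sémin. Congr. 10 (2005), Rem 7.1 (2). [Hironaka2005]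
-/

noncomputable section

open IsLocalRing Literature.AlgebraicGeometry.Resolution
open Summit.ResolutionOfSingularities.ResolutionOfSingularities.Theorems

set_option linter.dupNamespace false -- mandated namespace of this single-conjunct summit

namespace Summit.ResolutionOfSingularities.ResolutionOfSingularities.Cruxes.HypersurfaceCentreConstruction.LocalEngine

namespace Iota3

namespace RatContact

/-! ## §1 Small tools -/

section Tools

variable {T : Type} [CommRing T] [IsLocalRing T]

/-- Two-flags are a property of the residues in `𝔪/𝔪²`: perturbing both members by elements of `𝔪²` keeps a two-flag (the tree's
`IsTwoFlag.of_sub_mem_sq`, res-L1-w43-stub-3, read at `S′ = S`). [folklore] -/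
theorem isTwoFlag_of_sub_mem_sq {g₁ g₂ g₁' g₂' : T} (h : IsTwoFlag g₁ g₂) (h₁ : g₁' - g₁ ∈ maximalIdeal T ^ 2)
    (h₂ : g₂' - g₂ ∈ maximalIdeal T ^ 2) : IsTwoFlag g₁' g₂' :=
  IsTwoFlag.of_sub_mem_sq (S := T) (S' := T) (by rw [Algebra.algebraMap_self, Ideal.map_id]) h
    (by rw [Algebra.algebraMap_self, RingHom.id_apply, ← neg_sub]; exact neg_mem h₁)
    (by rw [Algebra.algebraMap_self, RingHom.id_apply, ← neg_sub]; exact neg_mem h₂)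

/-- Chaining cross-multiplied ratio inequalities `t₁/q₁ ≤ t₂/q₂ ≤ t₃/q₃` (`q₂ > 0`). [folklore] -/
theorem ratio_le_trans {t₁ q₁ t₂ q₂ t₃ q₃ : ℕ} (hq₂ : 0 < q₂) (h₁₂ : t₁ * q₂ ≤ t₂ * q₁) (h₂₃ : t₂ * q₃ ≤ t₃ * q₂) :
    t₁ * q₃ ≤ t₃ * q₁ := by
  refine Nat.le_of_mul_le_mul_right ?_ hq₂
  calc t₁ * q₃ * q₂ = t₁ * q₂ * q₃ := by ring
    _ ≤ t₂ * q₁ * q₃ := Nat.mul_le_mul_right _ h₁₂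
    _ = t₂ * q₃ * q₁ := by ring
    _ ≤ t₃ * q₂ * q₁ := Nat.mul_le_mul_right _ h₂₃
    _ = t₃ * q₁ * q₂ := by ring

/-- `e q ≤ x` ⇒ `e ≤ ⌈x/q⌉` (`q > 0`). [folklore] -/
theorem le_ceilDiv_of_mul_le {e q x : ℕ} (hq : 0 < q) (h : e * q ≤ x) : e ≤ x ⌈/⌉ q :=
  Nat.le_of_mul_le_mul_right (h.trans ((le_mul_ceilDiv hq).trans_eq (mul_comm _ _))) hq

end Tools

/-! ## §2 The step: a higher flag close to the given one -/

section Step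

variable {S : Type} [CommRing S] [IsLocalRing S]

/-- **THE STEP.**  Fix `f, ν` and `0 < b ≤ a`, assume (DOM_μ) and that the levels are UNBOUNDED.  Given a two-flag `h` carrying `f` at
`(q ; ta, tb)` with `2 ≤ k`, `k q ≤ t`, there is a two-flag `h'` carrying `f` at some `(q' ; t'a, t'b)` of level `≥ k + 1` and `≥ t/q`, with
`h₁' − h₁, h₂' − h₂ ∈ 𝔪^k`. [OURS · (EX-4) (L3) step] -/
theorem exists_next_flag {f : S} {ν a b : ℕ} (hb : 0 < b) (hba : b ≤ a)
    (hdom : ∀ (g₁ g₂ g₁' g₂' : S) (q t : ℕ), 0 < q → q ≤ t * b → IsTwoFlag g₁ g₂ → IsTwoFlag g₁' g₂' →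
      f ∈ flagContactFiltration g₁ g₂ q (t * a) (t * b) (t * a * ν) →
      f ∈ flagContactFiltration g₁' g₂' q (t * a) (t * b) (t * a * ν) →
      g₁' ∈ flagContactFiltration g₁ g₂ q (t * a) (t * b) (t * a) ∧ g₂' ∈ flagContactFiltration g₁ g₂ q (t * a) (t * b) (t * b))
    (hunb : ∀ L : ℕ, ∃ (g₁ g₂ : S) (q t : ℕ), 0 < q ∧ q ≤ t * b ∧ IsTwoFlag g₁ g₂ ∧
      f ∈ flagContactFiltration g₁ g₂ q (t * a) (t * b) (t * a * ν) ∧ L * q < t)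
    {h₁ h₂ : S} {q t k : ℕ} (hq : 0 < q) (hqt : q ≤ t * b) (hk2 : 2 ≤ k) (hk : k * q ≤ t) (hfl : IsTwoFlag h₁ h₂)
    (hmem : f ∈ flagContactFiltration h₁ h₂ q (t * a) (t * b) (t * a * ν)) :
    ∃ (h₁' h₂' : S) (q' t' : ℕ), 0 < q' ∧ q' ≤ t' * b ∧ (k + 1) * q' ≤ t' ∧ t * q' ≤ t' * q ∧ IsTwoFlag h₁' h₂' ∧
      f ∈ flagContactFiltration h₁' h₂' q' (t' * a) (t' * b) (t' * a * ν) ∧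
      h₁' - h₁ ∈ maximalIdeal S ^ k ∧ h₂' - h₂ ∈ maximalIdeal S ^ k := by
  -- a higher flag `g'`
  obtain ⟨g₁', g₂', q', t', hq', hqt', hfl', hmem', hlt⟩ := hunb (t + k + 1)
  have hlev : t * q' ≤ t' * q := by
    have h1 : t * q' ≤ (t + k + 1) * q' := Nat.mul_le_mul_right q' (by omega)
    have h2 : t' ≤ t' * q := Nat.le_mul_of_pos_right t' hq
    omega
  have hk' : (k + 1) * q' ≤ t' := by
    have h1 : (k + 1) * q' ≤ (t + k + 1) * q' := Nat.mul_le_mul_right q' (by omega)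
    omega
  -- `g'` reaches the lower triple `(q ; ta, tb)`
  have hmem'' : f ∈ flagContactFiltration g₁' g₂' q (t * a) (t * b) (t * a * ν) :=
    flagContactFiltration_ratio_antitone_level g₁' g₂' hq hq' hlev ν hmem'
  -- (DOM_μ): `h` sits inside the filtration of `g'` at the lower triple
  obtain ⟨hd₁, hd₂⟩ := hdom g₁' g₂' h₁ h₂ q t hq hqt hfl' hfl hmem'' hmem
  -- decompose along the level-free parts
  have hk_le : k ≤ t ⌈/⌉ q := le_ceilDiv_of_mul_le hq hk
  have hk_le₂ : k ≤ (t * b) ⌈/⌉ q := by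
    refine hk_le.trans ?_
    rw [ceilDiv_le_iff_le_smul hq, smul_eq_mul]
    exact (Nat.le_mul_of_pos_right t hb).trans (le_mul_ceilDiv hq)
  obtain ⟨i₁, hi₁, m₁, hm₁, hsum₁⟩ := Submodule.mem_sup.mp
    (flagContactFiltration_ratio_weight₁_le_big_sup_pow g₁' g₂' (a := a) (b := b) (t := t) hq hd₁)
  obtain ⟨i₂, hi₂, m₂, hm₂, hsum₂⟩ := Submodule.mem_sup.mp
    (flagContactFiltration_ratio_weight₂_le_span_sup_pow g₁' g₂' q (t * a) (t * b) hd₂)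
  have hm₁k : m₁ ∈ maximalIdeal S ^ k := Ideal.pow_le_pow_right hk_le hm₁
  have hm₂k : m₂ ∈ maximalIdeal S ^ k := Ideal.pow_le_pow_right hk_le₂ hm₂
  -- the new flag `(i₁, i₂)`
  have hsq : maximalIdeal S ^ k ≤ maximalIdeal S ^ 2 := Ideal.pow_le_pow_right hk2
  have hd₁' : i₁ - h₁ = -m₁ := by rw [← hsum₁]; ring
  have hd₂' : i₂ - h₂ = -m₂ := by rw [← hsum₂]; ring
  have hflI : IsTwoFlag i₁ i₂ :=
    isTwoFlag_of_sub_mem_sq hfl (by rw [hd₁']; exact neg_mem (hsq hm₁k)) (by rw [hd₂']; exact neg_mem (hsq hm₂k))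
  have hadm' : AdmissibleTriple q' (t' * a) (t' * b) := ⟨hq', hqt', Nat.mul_le_mul_left t' hba⟩
  -- `(i₁, i₂)` sits inside the HIGHER filtration of `g'`
  have hi₁' : i₁ ∈ flagContactFiltration g₁' g₂' q' (t' * a) (t' * b) (t' * a) :=
    big_le_flagContactFiltration_ratio_weight₁ g₁' g₂' hq' hi₁
  have hi₂' : i₂ ∈ flagContactFiltration g₁' g₂' q' (t' * a) (t' * b) (t' * b) :=
    span_pair_le_flagContactFiltration_weight₂ g₁' g₂' hadm' hi₂
  have heq : ∀ n, flagContactFiltration g₁' g₂' q' (t' * a) (t' * b) n = flagContactFiltration i₁ i₂ q' (t' * a) (t' * b) n :=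
    fun n => flagContactFiltration_eq_of_oneSided hflI hadm' hfl'.1 hfl'.2.1 hi₁' hi₂' n
  refine ⟨i₁, i₂, q', t', hq', hqt', hk', hlev, hflI, ?_, ?_, ?_⟩
  · rw [← heq]; exact hmem'
  · rw [hd₁']; exact neg_mem hm₁k
  · rw [hd₂']; exact neg_mem hm₂k

end Step

/-! ## §3 The limit: two-flag steepening terminates at an isolated position -/

section Limit

variable {S : Type} [CommRing S] [IsRegularLocalRing S]

/-- **THE UNIFORM LEVEL BOUND AT AN ISOLATED POSITION FROM DOMINANCE** ((EX-4) (L3); K6 for pairs).  `S` a regular local G-ring with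
`emb dim S > 2`; `f` of order `ν ≥ 1` (`iotaOrd S f = ν`) whose order is kept at NO prime `𝔭 ∋ f` other than `𝔪` (ISOLATED); a ratio `a/b`,
`0 < b ≤ a`; (DOM_μ) at the triples `(q ; ta, tb)`: two two-flags both carrying `f` to level `taν` are one-sidedly dominant.  THEN
`∃ L, ∀` two-flag carrying `f` at `(q ; ta, tb)`, `t ≤ L q`.  (Proof in the module docstring: step `exists_next_flag`, Cauchy sequence of
flags, limit two-flag `ĥ` in `Ŝ` carrying `f` at every stage's triple, `f ∈ (ĥ₁, ĥ₂)^ν` by the cylinder lemma, contradiction with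
`eq_maximalIdeal_adicCompletion_of_isolated`.) [OURS · L1 W4.3 · (o70-a) (EX-4) (L3)] [cite: Matsumura1987, Thm. 8.10, §32] -/
theorem levelBound_of_dominance_isolated (hG : IsGRing S) (h3 : 2 < (maximalIdeal S).spanFinrank) {f : S} {ν : ℕ}
    (hν1 : 1 ≤ ν) (hν : iotaOrd S f = (ν : ℕ))
    (hstrat : ∀ (𝔭 : Ideal S) [𝔭.IsPrime], f ∈ 𝔭 →
      (iotaOrd (Localization.AtPrime 𝔭) (algebraMap S (Localization.AtPrime 𝔭) f) = iotaOrd S f ↔ maximalIdeal S ≤ 𝔭))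
    {a b : ℕ} (hb : 0 < b) (hba : b ≤ a)
    (hdom : ∀ (g₁ g₂ g₁' g₂' : S) (q t : ℕ), 0 < q → q ≤ t * b → IsTwoFlag g₁ g₂ → IsTwoFlag g₁' g₂' →
      f ∈ flagContactFiltration g₁ g₂ q (t * a) (t * b) (t * a * ν) →
      f ∈ flagContactFiltration g₁' g₂' q (t * a) (t * b) (t * a * ν) →
      g₁' ∈ flagContactFiltration g₁ g₂ q (t * a) (t * b) (t * a) ∧ g₂' ∈ flagContactFiltration g₁ g₂ q (t * a) (t * b) (t * b)) :
    ∃ L : ℕ, ∀ (g₁ g₂ : S) (q t : ℕ), 0 < q → q ≤ t * b → IsTwoFlag g₁ g₂ →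
      f ∈ flagContactFiltration g₁ g₂ q (t * a) (t * b) (t * a * ν) → t ≤ L * q := by
  by_contra hno
  push Not at hno
  -- the state predicate on tuples `(h₁, h₂, q, t)`: a two-flag carrying `f` at `(q ; ta, tb)`, level `t/q ≥ k`
  let P : ℕ → S × S × ℕ × ℕ → Prop := fun k p => 0 < p.2.2.1 ∧ p.2.2.1 ≤ p.2.2.2 * b ∧ k * p.2.2.1 ≤ p.2.2.2 ∧
    IsTwoFlag p.1 p.2.1 ∧ f ∈ flagContactFiltration p.1 p.2.1 p.2.2.1 (p.2.2.2 * a) (p.2.2.2 * b) (p.2.2.2 * a * ν)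
  have step : ∀ (k : ℕ) (p : S × S × ℕ × ℕ), 2 ≤ k → P k p → ∃ p' : S × S × ℕ × ℕ, P (k + 1) p' ∧
      p.2.2.2 * p'.2.2.1 ≤ p'.2.2.2 * p.2.2.1 ∧ p'.1 - p.1 ∈ maximalIdeal S ^ k ∧ p'.2.1 - p.2.1 ∈ maximalIdeal S ^ k := by
    rintro k ⟨h₁, h₂, q, t⟩ hk2 ⟨hq, hqt, hk, hfl, hmem⟩
    obtain ⟨h₁', h₂', q', t', hq', hqt', hk', hlev, hfl', hmem', hd₁, hd₂⟩ :=
      exists_next_flag hb hba hdom hno hq hqt hk2 hk hfl hmem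
    exact ⟨(h₁', h₂', q', t'), ⟨hq', hqt', hk', hfl', hmem'⟩, hlev, hd₁, hd₂⟩
  choose! next hnext using step
  -- the sequence, stage `n` at level `≥ n + 2`
  obtain ⟨g₁, g₂, q₀, t₀, hq₀, hqt₀, hfl₀, hmem₀, hlt₀⟩ := hno 2
  let seq : ℕ → S × S × ℕ × ℕ := fun n => Nat.rec (g₁, g₂, q₀, t₀) (fun n p => next (n + 2) p) n
  have hseq : ∀ n, seq (n + 1) = next (n + 2) (seq n) := fun n => rfl
  have hP : ∀ n, P (n + 2) (seq n) := by
    intro n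
    induction n with
    | zero => exact ⟨hq₀, hqt₀, hlt₀.le, hfl₀, hmem₀⟩
    | succ n ih => rw [hseq]; exact (hnext (n + 2) (seq n) (by omega) ih).1
  have hst : ∀ n, (seq n).2.2.2 * (seq (n + 1)).2.2.1 ≤ (seq (n + 1)).2.2.2 * (seq n).2.2.1 ∧
      (seq (n + 1)).1 - (seq n).1 ∈ maximalIdeal S ^ (n + 2) ∧ (seq (n + 1)).2.1 - (seq n).2.1 ∈ maximalIdeal S ^ (n + 2) :=
    fun n => by rw [hseq]; exact (hnext (n + 2) (seq n) (by omega) (hP n)).2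
  -- levels increase along the sequence
  have hratio : ∀ {k m : ℕ}, k ≤ m → (seq k).2.2.2 * (seq m).2.2.1 ≤ (seq m).2.2.2 * (seq k).2.2.1 := by
    intro k m hkm
    induction m, hkm using Nat.le_induction with
    | base => exact le_rfl
    | succ m _ ih => exact ratio_le_trans (hP m).1 ih (hst m).1
  -- the members are Cauchy
  have hmono : StrictMono fun n : ℕ => n + 2 := fun _ _ h => Nat.add_lt_add_right h 2
  have hC₁ : ∀ {k m : ℕ}, k ≤ m → (seq m).1 - (seq k).1 ∈ maximalIdeal S ^ k := fun hkm =>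
    LocalGameEFTContact.sub_mem_maximalIdeal_pow_of_adicSteps (fun n => (seq n).1) hmono (fun n => (hst n).2.1) hkm
  have hC₂ : ∀ {k m : ℕ}, k ≤ m → (seq m).2.1 - (seq k).2.1 ∈ maximalIdeal S ^ k := fun hkm =>
    LocalGameEFTContact.sub_mem_maximalIdeal_pow_of_adicSteps (fun n => (seq n).2.1) hmono (fun n => (hst n).2.2) hkm
  -- the limit two-flag `ĥ` in `Ŝ`
  obtain ⟨ĥ₁, hĥ₁⟩ := LocalGameEFTContact.exists_limit (fun n => (seq n).1) hC₁
  obtain ⟨ĥ₂, hĥ₂⟩ := LocalGameEFTContact.exists_limit (fun n => (seq n).2.1) hC₂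
  haveI : IsNoetherianRing (AdicCompletion (maximalIdeal S) S) := isNoetherianRing_adicCompletion_maximalIdeal S
  haveI : IsRegularLocalRing (AdicCompletion (maximalIdeal S) S) := isRegularLocalRing_adicCompletion S
  have hm : (maximalIdeal S).map (algebraMap S (AdicCompletion (maximalIdeal S) S)) =
      maximalIdeal (AdicCompletion (maximalIdeal S) S) := AdicCompletion.maximalIdeal_eq_map.symm
  have hflĥ : IsTwoFlag ĥ₁ ĥ₂ := isTwoFlag_of_sub_mem_sq ((hP 2).2.2.2.1.algebraMap_of_flat hm) (hĥ₁ 2) (hĥ₂ 2)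
  -- `ĥ` carries `f` at EVERY stage's triple
  have hreach : ∀ k, algebraMap S (AdicCompletion (maximalIdeal S) S) f ∈
      flagContactFiltration ĥ₁ ĥ₂ (seq k).2.2.1 ((seq k).2.2.2 * a) ((seq k).2.2.2 * b) ((seq k).2.2.2 * a * ν) := by
    intro k
    obtain ⟨hQk, hQTk, -, -, -⟩ := hP k
    obtain ⟨hQj, -, -, hflj, hmemj⟩ := hP ((seq k).2.2.2 * a + k)
    -- a late stage `j = T_k a + k` reaches the stage-`k` triple; push to `Ŝ`
    have hφ := map_mem_flagContactFiltration (algebraMap S (AdicCompletion (maximalIdeal S) S)) hm.le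
      (flagContactFiltration_ratio_antitone_level _ _ hQk hQj (hratio (Nat.le_add_left k _)) ν hmemj)
    -- `ĥ` is one-sidedly dominated by the image of stage `j` at the stage-`k` triple
    have hw : (seq k).2.2.2 * a ≤ (seq k).2.2.1 * ((seq k).2.2.2 * a + k) :=
      (Nat.le_add_right _ k).trans (Nat.le_mul_of_pos_left _ hQk)
    have hδ₁ : ĥ₁ ∈ flagContactFiltration (algebraMap S (AdicCompletion (maximalIdeal S) S) (seq ((seq k).2.2.2 * a + k)).1)
        (algebraMap S (AdicCompletion (maximalIdeal S) S) (seq ((seq k).2.2.2 * a + k)).2.1) (seq k).2.2.1 ((seq k).2.2.2 * a) ((seq k).2.2.2 * b)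
        ((seq k).2.2.2 * a) := by
      have hg := pow_left_mem_flagContactFiltration (g₁ := algebraMap S (AdicCompletion (maximalIdeal S) S) (seq ((seq k).2.2.2 * a + k)).1)
        (g₂ := algebraMap S (AdicCompletion (maximalIdeal S) S) (seq ((seq k).2.2.2 * a + k)).2.1) (q := (seq k).2.2.1) (r₁ := (seq k).2.2.2 * a)
        (r₂ := (seq k).2.2.2 * b) (n := (seq k).2.2.2 * a) (α := 1) hQk (by rw [mul_one])
      rw [pow_one] at hg
      have := Ideal.add_mem _ hg (mem_flagContactFiltration_of_mem_pow
        (g₁ := algebraMap S (AdicCompletion (maximalIdeal S) S) (seq ((seq k).2.2.2 * a + k)).1)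
        (g₂ := algebraMap S (AdicCompletion (maximalIdeal S) S) (seq ((seq k).2.2.2 * a + k)).2.1) (r₁ := (seq k).2.2.2 * a)
        (r₂ := (seq k).2.2.2 * b) hQk (hĥ₁ ((seq k).2.2.2 * a + k)) hw)
      rwa [add_sub_cancel] at this
    have hδ₂ : ĥ₂ ∈ flagContactFiltration (algebraMap S (AdicCompletion (maximalIdeal S) S) (seq ((seq k).2.2.2 * a + k)).1)
        (algebraMap S (AdicCompletion (maximalIdeal S) S) (seq ((seq k).2.2.2 * a + k)).2.1) (seq k).2.2.1 ((seq k).2.2.2 * a) ((seq k).2.2.2 * b)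
        ((seq k).2.2.2 * b) := by
      have hg := pow_right_mem_flagContactFiltration (g₁ := algebraMap S (AdicCompletion (maximalIdeal S) S) (seq ((seq k).2.2.2 * a + k)).1)
        (g₂ := algebraMap S (AdicCompletion (maximalIdeal S) S) (seq ((seq k).2.2.2 * a + k)).2.1) (q := (seq k).2.2.1) (r₁ := (seq k).2.2.2 * a)
        (r₂ := (seq k).2.2.2 * b) (n := (seq k).2.2.2 * b) (β := 1) hQk (by rw [mul_one])
      rw [pow_one] at hg
      have := Ideal.add_mem _ hg (mem_flagContactFiltration_of_mem_pow
        (g₁ := algebraMap S (AdicCompletion (maximalIdeal S) S) (seq ((seq k).2.2.2 * a + k)).1)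
        (g₂ := algebraMap S (AdicCompletion (maximalIdeal S) S) (seq ((seq k).2.2.2 * a + k)).2.1) (r₁ := (seq k).2.2.2 * a)
        (r₂ := (seq k).2.2.2 * b) hQk (hĥ₂ ((seq k).2.2.2 * a + k)) ((Nat.mul_le_mul_left _ hba).trans hw))
      rwa [add_sub_cancel] at this
    rw [← flagContactFiltration_eq_of_oneSided hflĥ ⟨hQk, hQTk, Nat.mul_le_mul_left _ hba⟩
      (hm.le (Ideal.mem_map_of_mem _ hflj.1)) (hm.le (Ideal.mem_map_of_mem _ hflj.2.1)) hδ₁ hδ₂]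
    exact hφ
  -- the cylinder end: `f ∈ (ĥ₁, ĥ₂)^ν`
  have hpow : algebraMap S (AdicCompletion (maximalIdeal S) S) f ∈ Ideal.span {ĥ₁, ĥ₂} ^ ν := by
    refine mem_span_pair_pow_of_forall_level fun e => ?_
    obtain ⟨hQ, hQT, heQ, -, -⟩ := hP e
    refine ⟨(seq e).2.2.1, (seq e).2.2.2 * a, (seq e).2.2.2 * b, ⟨hQ, hQT, Nat.mul_le_mul_left _ hba⟩,
      le_ceilDiv_of_mul_le hQ ?_, hreach e⟩
    calc e * (seq e).2.2.1 ≤ (e + 2) * (seq e).2.2.1 := Nat.mul_le_mul_right _ (Nat.le_add_right e 2)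
      _ ≤ (seq e).2.2.2 := heQ
      _ ≤ (seq e).2.2.2 * b := Nat.le_mul_of_pos_right _ hb
  -- the descent end: the equimultiple formal prime `(ĥ₁, ĥ₂)` would be `𝔪̂`
  haveI := isPrime_span_pair_of_isTwoFlag hflĥ
  have h3' : 2 < (maximalIdeal (AdicCompletion (maximalIdeal S) S)).spanFinrank := by
    rwa [AdicCompletion.spanFinrank_maximalIdeal_eq]
  exact span_pair_ne_maximalIdeal ĥ₁ ĥ₂ h3'
    (eq_maximalIdeal_adicCompletion_of_isolated hG hν1 hν hstrat _ (mem_pow_maximalIdeal_localization_of_mem_pow hpow))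

end Limit

/-! ## §4 (EX-4) at ONE isolated position from the dominance word -/

section Isolated

variable {S : Type} [CommRing S] [IsRegularLocalRing S]

/-- **(EX-4) AT AN ISOLATED POSITION ⟸ (DOM_μ).**  `S` an excellent regular local ring of dimension `3`, `0 ≠ f ∈ 𝔪²` not of monomial
type whose order is kept at no prime `𝔭 ∋ f` other than `𝔪`; `hdom` = SPEC (Δ12) rev 3 `Iota3.TwoFlagDominanceAtLevelAt f` WITH THE
REPAIR `0 < b` (FINDING res-D-pv-038 2026-08-27T20:30:32Z: the instance `a = b = 0` of the unrepaired word is refutable), spelled out.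
THEN the conclusion of (EX-4) (`hlev` of `Iota3.sigmaMaximiserExistsLE3_of_levelBound`) holds at `(S, f)`: the two-flags reaching an
admissible triple of lex-maximal ratio have `r₁ ≤ L q`.  (Max ratio `a/b` attained: `exists_flagReaches_ratio_max`; a lex-maximal reached
triple has ratio `a/b`, and scaling it by `b` makes it `(bq ; r₂a, r₂b)`, where §3 bounds `r₂ ≤ L b q`.)
[OURS · L1 W4.3 · (o70-a) (EX-4) at isolated positions ⟸ (DOM_μ)] -/
theorem levelBound_isolated_of_dominanceAtLevel (hS : IsExcellentRing S) (hdim : ringKrullDim S = 3) {f : S} (hf0 : f ≠ 0)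
    (hf2 : f ∈ maximalIdeal S ^ 2) (hnm : ¬ IsMonomialType f)
    (hstrat : ∀ (𝔭 : Ideal S) [𝔭.IsPrime], f ∈ 𝔭 →
      (iotaOrd (Localization.AtPrime 𝔭) (algebraMap S (Localization.AtPrime 𝔭) f) = iotaOrd S f ↔ maximalIdeal S ≤ 𝔭))
    (hdom : ∀ (a b : ℕ), 0 < b →
      (∀ q' r₁' r₂' : ℕ, AdmissibleTriple q' r₁' r₂' → FlagReaches f (adicOrder f).toNat q' r₁' r₂' → r₁' * b ≤ a * r₂') →
      ∀ (g₁ g₂ g₁' g₂' : S) (q r₁ r₂ : ℕ), AdmissibleTriple q r₁ r₂ → r₁ * b = a * r₂ → IsTwoFlag g₁ g₂ → IsTwoFlag g₁' g₂' →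
        f ∈ flagContactFiltration g₁ g₂ q r₁ r₂ (r₁ * (adicOrder f).toNat) →
        f ∈ flagContactFiltration g₁' g₂' q r₁ r₂ (r₁ * (adicOrder f).toNat) →
        g₁' ∈ flagContactFiltration g₁ g₂ q r₁ r₂ r₁ ∧ g₂' ∈ flagContactFiltration g₁ g₂ q r₁ r₂ r₂) :
    ∃ L : ℕ, ∀ (g₁ g₂ : S) (q r₁ r₂ : ℕ), AdmissibleTriple q r₁ r₂ → IsTwoFlag g₁ g₂ →
      f ∈ flagContactFiltration g₁ g₂ q r₁ r₂ (r₁ * (adicOrder f).toNat) →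
      (∀ q' r₁' r₂' : ℕ, AdmissibleTriple q' r₁' r₂' → FlagReaches f (adicOrder f).toNat q' r₁' r₂' → r₁' * r₂ ≤ r₁ * r₂') →
      r₁ ≤ L * q := by
  -- the order `ν`
  have hfin : adicOrder f ≠ ⊤ := fun h => hf0 ((adicOrder_eq_top_iff f).mp h)
  have hνeq : adicOrder f = ((adicOrder f).toNat : ℕ∞) := (ENat.coe_toNat hfin).symm
  have hν1 : 1 ≤ (adicOrder f).toNat := by
    have h := Nat.cast_le.mp (((le_adicOrder_iff f 2).mpr hf2).trans hνeq.le)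
    omega
  have hν : iotaOrd S f = ((adicOrder f).toNat : ℕ) := by
    refine (iotaOrd_eq_natCast_iff S f _).mpr ⟨(le_adicOrder_iff f _).mp hνeq.ge, fun h => ?_⟩
    have h' := Nat.cast_le.mp (((le_adicOrder_iff f _).mpr h).trans hνeq.le)
    omega
  have h3 : 2 < (maximalIdeal S).spanFinrank := by rw [spanFinrank_eq_three_of_ringKrullDim hdim]; norm_num
  -- the maximal ratio `a/b` (attained) and §3
  obtain ⟨ga, gb, a, b, hadm, hflab, hmemab, hbound⟩ := exists_flagReaches_ratio_max hS hdim hf0 hf2 hnm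
  obtain ⟨L, hL⟩ := levelBound_of_dominance_isolated hS.isQuasiExcellentRing.isGRing h3 hν1 hν hstrat hadm.1 hadm.2.2
    fun g₁ g₂ g₁' g₂' q t hq hqt hfl hfl' hmem hmem' =>
      hdom a b hadm.1 hbound g₁ g₂ g₁' g₂' q (t * a) (t * b) ⟨hq, hqt, Nat.mul_le_mul_left t hadm.2.2⟩ (by ring) hfl hfl'
        hmem hmem'
  refine ⟨L * a, fun g₁ g₂ q r₁ r₂ hadm' hfl hmem hlex => ?_⟩
  -- a lex-maximal reached triple has ratio `a/b`
  have heq : r₁ * b = a * r₂ :=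
    le_antisymm (hbound q r₁ r₂ hadm' ⟨g₁, g₂, hfl, hmem⟩) (hlex b a b hadm ⟨ga, gb, hflab, hmemab⟩)
  -- scale it by `b`: `(bq ; r₂a, r₂b)`
  have hmem' : f ∈ flagContactFiltration g₁ g₂ (b * q) (r₂ * a) (r₂ * b) (r₂ * a * (adicOrder f).toNat) := by
    rw [← flagContactFiltration_scale g₁ g₂ hadm'.1 hadm.1 r₁ r₂ (r₁ * (adicOrder f).toNat)] at hmem
    have hbr₁ : r₂ * a = b * r₁ := by rw [mul_comm r₂ a, ← heq, mul_comm]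
    rw [hbr₁, mul_comm r₂ b, mul_assoc]
    exact hmem
  have hr₂ : r₂ ≤ L * (b * q) :=
    hL g₁ g₂ (b * q) r₂ (Nat.mul_pos hadm.1 hadm'.1) (by rw [mul_comm b q]; exact Nat.mul_le_mul_right b hadm'.2.1) hfl hmem'
  refine Nat.le_of_mul_le_mul_right ?_ hadm.1
  calc r₁ * b = a * r₂ := heq
    _ ≤ a * (L * (b * q)) := Nat.mul_le_mul_left a hr₂
    _ = L * a * q * b := by ring

end Isolated

end RatContact

end Iota3

end Summit.ResolutionOfSingularities.ResolutionOfSingularities.Cruxes.HypersurfaceCentreConstruction.LocalEngine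

end
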